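import Summits.CriticalPhenomena.PercolationContinuityZ3.Theorems.PercNearOneGluingNoHeavyLowerTailUpsetExchangeUnion
import Literature.Probability.Percolation.TwoClusterConditionalAssociation
import HarnessLib

/-!
# `NoHeavyLowerTail` (stmt-CriticalPhenomena-4575) — the POCKET–GLUE EXCHANGE: Kozma–Nitzan's gluing Lemma 5 restricted to
# the event that the glued (black-box) vertex reaches the relays on its own

Support file (`prim-nh-dp-blobmono` gen 9; `--supports stmt-CriticalPhenomena-4575`).  No definitions, no named facts, no sorries.
Memo: `run/shared/lean/prim/prim-nh-dp-blobmono/gen9-g9/BLACKBOX-KERNEL-ADDENDUM.md` §A8.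

Setting (`Fin n`, weights `w`).  `s` an ARBITRARY vertex (the 'black box': anything may hang behind it), `c` a vertex with
`μ_w(j ↔ b) ≤ μ_w(c ↔ b)` (the split row of `c` over the witness `j`; `j` need not be a minimiser), `A` any vertex set.  Glue `s`
to `c` (weight `1` on the pair `s(s,c)`) and let `E := {s ↔ A by an open path avoiding the pair s(s,c)}` ("`s` reaches a relay on its
own", the complement of Kozma–Nitzan's pocket events of `s`).  Then
  `μ_{glue}(j ↔ b, E) ≤ μ_{glue}(c ↔ b, E)`      (`pocketGlue_exchange`).
Without `E` this is KN's Lemma 5 (gluing transfer).  With `E` it is the identity-level content of the "exchange-strengthened Question 9"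
of the memo (§A7–A8): for every graph, every vertex `s`, every relay `c` above `j`,
  `μ(s↔b) − μ(j↔b, s↔A) ≥ μ(s↔b, c↮b, j∼c) − μ(c↔b, s↮b, s↔A, j≁s)`,
because the pocket part of `([sc] − j)_{G/sc}` is exactly the pocket-weighted row of `c` (memo identity, verified in exact arithmetic).
Proof: `UpsetExchange.upsetExchange_event` (prim-lf-3) with block `{s, c}`, anchor `c`, compared vertex `j`: on `{s(s,c) open}` the
event `E` is increasing in the open edge cluster of `c` — an `s–A` path avoiding `s(s,c)` lies in that cluster, and the cluster of a
configuration carries its own paths (`reachable_within_openEdgeCluster`).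
-/

namespace Summit.CriticalPhenomena.PercolationContinuityZ3.Theorems

open MeasureTheory Set ProbabilityTheory
open Literature.Probability.LatticeModels
open Literature.Probability.Percolation

noncomputable section
open Classical

namespace PocketGlue

variable {n : ℕ}

/-- **A configuration's open edge cluster carries its own paths**: if `s ↔ a` in `ω` then `s ↔ a` using only the edges of
`openEdgeCluster ω s`. [folklore] -/
theorem reachable_within_openEdgeCluster (ω : BondConfig (Fin n)) (s a : Fin n)
    (h : (openGraph ω).Reachable s a) : (openGraph (openEdgeCluster ω s)).Reachable s a := by
  obtain ⟨p⟩ := h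
  have hp : ∀ e, e ∈ p.edges → e ∈ (openGraph (openEdgeCluster ω s)).edgeSet := by
    intro e he
    have heG : e ∈ (openGraph ω).edgeSet := p.edges_subset_edgeSet he
    rw [openGraph, SimpleGraph.edgeSet_fromEdgeSet] at heG ⊢
    refine ⟨⟨heG.1, ?_, ?_⟩, heG.2⟩
    · intro hd; exact heG.2 hd
    · intro v hv
      -- `v` is an endpoint of an edge of the walk, hence on its support, hence reachable from `s`
      have hvsupp : v ∈ p.support := by
        induction e using Sym2.ind with
        | h x y =>
          rcases Sym2.mem_iff.1 hv with rfl | rfl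
          · exact p.fst_mem_support_of_mem_edges he
          · exact p.snd_mem_support_of_mem_edges he
      exact (p.takeUntil v hvsupp).reachable
  exact ⟨p.transfer _ hp⟩

/-- **Pocket–glue exchange.**  `s ≠ c`, `μ_w(j ↔ b) ≤ μ_w(c ↔ b)`; `g` := `w` with the pair `s(s,c)` glued (weight `1`);
`E := {ω | ∃ a ∈ A, s ↔ a in ω ∖ {s(s,c)}}`.  Then `μ_g(j ↔ b ∩ E) ≤ μ_g(c ↔ b ∩ E)`.
[cite: KozmaNitzan2024, Lemma 5 and Lemma 3(i) (pp. 6, 13); VandenbergHaggstromKahn2005, Thm. 1.2] -/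
theorem pocketGlue_exchange (w : Sym2 (Fin n) → unitInterval) (A : Finset (Fin n)) (s c j b : Fin n) (hsc : s ≠ c)
    (hyp : (prodBernoulli w).real (openConn j b) ≤ (prodBernoulli w).real (openConn c b)) :
    (prodBernoulli (fun e : Sym2 (Fin n) => if (∀ x ∈ e, x ∈ ({s, c} : Finset (Fin n))) ∧ ¬ e.IsDiag then 1 else w e)).real
        (openConn j b ∩ {ω | ∃ a ∈ A, (openGraph (ω \ {s(s, c)})).Reachable s a}) ≤
      (prodBernoulli (fun e : Sym2 (Fin n) => if (∀ x ∈ e, x ∈ ({s, c} : Finset (Fin n))) ∧ ¬ e.IsDiag then 1 else w e)).real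
        (openConn c b ∩ {ω | ∃ a ∈ A, (openGraph (ω \ {s(s, c)})).Reachable s a}) := by
  set S : Finset (Fin n) := {s, c} with hS
  set E : Set (BondConfig (Fin n)) := {ω | ∃ a ∈ A, (openGraph (ω \ {s(s, c)})).Reachable s a} with hE
  -- the pairs inside `S` that are not loops: exactly `s(s,c)`
  have hpair : ∀ e : Sym2 (Fin n), (∀ x ∈ e, x ∈ S) → ¬ e.IsDiag → e = s(s, c) := by
    intro e heS hed
    induction e using Sym2.ind with
    | h x y =>
      have hx : x ∈ S := heS x (Sym2.mem_mk_left x y)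
      have hy : y ∈ S := heS y (Sym2.mem_mk_right x y)
      have hxy : x ≠ y := fun h => hed (by subst h; exact rfl)
      rw [hS, Finset.mem_insert, Finset.mem_singleton] at hx hy
      rcases hx with rfl | rfl <;> rcases hy with rfl | rfl
      · exact absurd rfl hxy
      · rfl
      · exact Sym2.eq_swap
      · exact absurd rfl hxy
  have hsc_mem : ∀ ω : BondConfig (Fin n), (∀ e : Sym2 (Fin n), (∀ x ∈ e, x ∈ S) → ¬ e.IsDiag → e ∈ ω) → s(s, c) ∈ ω := by
    intro ω hF
    refine hF _ (fun x hx => ?_) (fun h => hsc (Sym2.mk_isDiag_iff.1 h))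
    rw [hS, Finset.mem_insert, Finset.mem_singleton]
    rcases Sym2.mem_iff.1 hx with rfl | rfl
    · exact Or.inl rfl
    · exact Or.inr rfl
  -- `E ∩ {s(s,c) open}` is increasing in the open edge cluster of the anchor `c`
  have hEincr : ∀ ω ω' : BondConfig (Fin n), ω ∈ E →
      (∀ e : Sym2 (Fin n), (∀ x ∈ e, x ∈ S) → ¬ e.IsDiag → e ∈ ω) →
      openEdgeCluster ω c ⊆ openEdgeCluster ω' c →
      ω' ∈ E ∧ ∀ e : Sym2 (Fin n), (∀ x ∈ e, x ∈ S) → ¬ e.IsDiag → e ∈ ω' := by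
    intro ω ω' hω hF hsub
    have hscω : s(s, c) ∈ ω := hsc_mem ω hF
    -- `c ↔ s` in `ω` through the glued pair
    have hcs : (openGraph ω).Reachable c s := by
      refine SimpleGraph.Adj.reachable ?_
      rw [openGraph_adj]; exact ⟨by rw [Sym2.eq_swap]; exact hscω, fun h => hsc h.symm⟩
    -- the glued pair lies in the open edge cluster of `c`, hence stays open in `ω'`
    have hsc_cl : s(s, c) ∈ openEdgeCluster ω c := by
      rw [mem_openEdgeCluster_iff]
      refine ⟨hscω, fun h => hsc (Sym2.mk_isDiag_iff.1 h), fun v hv => ?_⟩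
      rcases Sym2.mem_iff.1 hv with rfl | rfl
      · exact hcs
      · exact SimpleGraph.Reachable.refl _
    have hscω' : s(s, c) ∈ ω' := openEdgeCluster_subset ω' c (hsub hsc_cl)
    refine ⟨?_, fun e heS hed => by rw [hpair e heS hed]; exact hscω'⟩
    -- transport the `s–A` path: it lives in the cluster of `s` in `ω ∖ {sc}`, which is inside the cluster of `c` in `ω`
    obtain ⟨a, haA, hreach⟩ := hω
    have hin := reachable_within_openEdgeCluster (ω \ {s(s, c)}) s a hreach
    have hsubset : openEdgeCluster (ω \ {s(s, c)}) s ⊆ ω' \ {s(s, c)} := by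
      intro e he
      rw [mem_openEdgeCluster_iff] at he
      obtain ⟨heω, hed, hev⟩ := he
      have he' : e ∈ openEdgeCluster ω c := by
        rw [mem_openEdgeCluster_iff]
        refine ⟨heω.1, hed, fun v hv => hcs.trans ?_⟩
        exact SimpleGraph.Reachable.mono (openGraph_mono Set.sdiff_subset) (hev v hv)
      exact ⟨openEdgeCluster_subset ω' c (hsub he'), heω.2⟩
    exact ⟨a, haA, SimpleGraph.Reachable.mono (openGraph_mono hsubset) hin⟩
  exact UpsetExchange.upsetExchange_event w S j b c E hEincr hyp

end PocketGlue

end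

end Summit.CriticalPhenomena.PercolationContinuityZ3.Theorems
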